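import Literature.Topology.FourManifolds.TubeFibreSum
import HarnessLib

/-!
# Regluing a tube by a fibred conical diffeomorphism: torus surgery exists (tube coordinates)

Topic `Literature/Topology/FourManifolds` (fact seat of the Seiberg–Witten leaf
`Literature.Barriers.SmoothPoincare4.akhmedovPark2010_lemma8_invariants`, A. Akhmedov,
B. D. Park, Invent. Math. 181 (2010), §2 and §9: the blocks `Y₁(1/p, 1/q)`, `Z''(1/q, m/r)` of
`X₁(m)` are obtained from `Σ₂ × T²` and `T⁴ # ℂℙ²bar` by Luttinger / torus surgeries — "remove a
tubular neighbourhood `T² × D²` of a torus and glue it back by a diffeomorphism of `T³`",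
R. Gompf, A. Stipsicz, *4-Manifolds and Kirby Calculus* (1999), §8.3 p. 311).  Companion of
`TubeFibreSum.lean` (fibre sums exist); same method.

Let `T : F × ℝᶜ → Y` be a tube (a smooth open embedding, `F` compact, `Y` closed) and
`Ψ, Ψ' : F × ℝᶜ → F × ℝᶜ` a pair of mutually inverse **fibred regluing maps** of the punctured
tube: `C^∞` on `F × (ℝᶜ ∖ 0)`, preserving the radius `‖v‖`, and `Ψ` *conical*
(`Ψ(f, t u) = ((Ψ(f, u)).1, t (Ψ(f, u)).2)` for `t > 0`, `‖u‖ = 1`) — e.g. the linear regluings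
`ψ_A`, `A ∈ GL(3, ℤ)`, of `T³ × (0, ∞)` of a torus surgery (`TorusSurgery.lean`), or the
rotation map of a Gluck twist.  This file CONSTRUCTS the reglued manifold
`P = (Y ∖ T(F × 0)) ∪_Ψ T(F × B(0, 1))`, the open gluing of the complement of the core with a
second copy of the open unit tube in which the new point `T(f, v)` is attached to the old point
`T(Ψ(f, v))` (`0 < ‖v‖ < 1`), and proves that it is a **regluing of the tube piece
`{g ≤ ¼} = T(F × B̄(0, ½))` to the tube complement `{¼ ≤ g} = Y ∖ T(F × B(0, ½))` along their
boundaries** in the sense of the tree's `BoundaryGluingData` — exactly the datum `(P, φ', GP)`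
consumed by `Literature.Barriers.SmoothPoincare4.akhmedovPark2010_lemma8_block_of_tube_regluing`
(`SmallExoticaFrontierReductionLemma8BlocksProofs.lean`, §12: the block data pass through a torus
surgery) and by `exists_signature_eq_of_tube_regluing`, `isOrientableOver_int_of_tube_regluing`,
`relEuler_eq_of_tube_regluing`, `exists_tube_transport`, all of which take the reglued manifold
as a hypothesis.  Everything is PROVED; there is no definition and no named fact:

* §1 `contMDiffOn_corestrict_tubeMap`, `isClosed_graph_reglue`, `isCompact_preimage_closedTube` —
  smoothness of the corestricted transition maps `T(q) ↦ T'(Φ q)` into open pieces, closedness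
  of the graph of the regluing (the trace on `A × B` of the compact set
  `{(T((Ψ(f,u)).1, t (Ψ(f,u)).2), T(f, t u))}`, `t ∈ [0, 1]`: at `t = 0` the first coordinate is
  on the removed core, at `t = 1` the second is outside the open unit tube), compactness of the
  closed half tube inside the open unit tube;
* §2 `exists_smoothGlueData_reglue` — the open gluing datum
  `D : SmoothGlueData (𝓡 _) (𝓡 _) A B ℝᵏ⁺¹`, `A = Y ∖ T(F × 0)`, `B = T(F × B(0,1))`, with gluing
  map `T q ↦ T(Ψ' q)` on the punctured unit tube (inverse `T q ↦ T(Ψ q)`), whose glued space is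
  Hausdorff, compact and second countable;
* §3 `exists_tubeRegluing_boundaryGluingData` — **the surgery exists**: for a tube function `g`
  of `T` there are a closed smooth manifold `P`, a bijection `φ' : ∂{¼ ≤ g} ≃ ∂{g ≤ ¼}` with
  `φ'(T q) = T(Ψ' q)` on the level sphere bundle `‖q.2‖ = ½`, gluing data
  `GP : BoundaryGluingData (boundaryData _) (boundaryData _) φ' P` (`jA = inl ∘ incl`,
  `jB = inr ∘ incl`), and the two open smooth embeddings `ι : A → P`, `ι' : B → P` of the
  construction with `jA = ι ∘ incl`, `jB = ι' ∘ incl`, `range ι ∪ range ι' = P` and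
  `ι a = ι' b ↔ b = T q, a = T(Ψ q)` (`0 < ‖q.2‖ < 1`) — so that further tubes of `Y` away from
  the core are transported to SMOOTH tubes `ι ∘ T₀` of `P`.

## References

* R. E. Gompf, A. I. Stipsicz, *4-Manifolds and Kirby Calculus*, GSM 20, AMS 1999, §8.3 p. 311
  (torus surgery / logarithmic transformation: `X_K = (X ∖ νT) ∪_φ (T² × D²)`).
  [GompfStipsiczGSM1999]
* A. Akhmedov, B. D. Park, Invent. Math. 181 (2010) 577–603, §2 (Luttinger surgery), §9.
  [AkhmedovPark2010]
* A. Kosinski, *Differential Manifolds* (1993), VI.1 (gluing along open subsets; Hausdorffness).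
  [Kosinski1993]
* H. Gluck, *The embedding of two-spheres in the four-sphere*, Trans. AMS 104 (1962), §17 (the
  regluing of `S² × D²` by the rotation map). [Gluck1962]
-/

noncomputable section

open scoped Manifold ContDiff Topology
open Set Function Metric

namespace Literature.Topology.FourManifolds

/-! ### §1 Corestricted tube maps, the graph of the regluing, compact pieces -/

section Lemmas

variable {k d c : ℕ}
  {Y₁ : Type} [TopologicalSpace Y₁] [ChartedSpace (EuclideanSpace ℝ (Fin (k + 1))) Y₁]
  {Y₂ : Type} [TopologicalSpace Y₂] [ChartedSpace (EuclideanSpace ℝ (Fin (k + 1))) Y₂]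
  {F : Type} [TopologicalSpace F] [ChartedSpace (EuclideanSpace ℝ (Fin d)) F]
  {T₁ : F × EuclideanSpace ℝ (Fin c) → Y₁} {T₂ : F × EuclideanSpace ℝ (Fin c) → Y₂}

/-- **The tube map `T₁ q ↦ T₂ (Φ q)` is `C^∞` on the punctured tube** for a fibre map `Φ`
which is `C^∞` off the zero section (`Φ = Ψ, Ψ'` of a regluing; compare
`contMDiffOn_transition`, the case of the radial flip). [folklore] -/
theorem contMDiffOn_tubeMap [Nonempty F]
    (hT : Manifold.IsSmoothEmbedding ((𝓡 d).prod (𝓡 c)) (𝓡 (k + 1)) ∞ T₁)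
    (hT' : Manifold.IsSmoothEmbedding ((𝓡 d).prod (𝓡 c)) (𝓡 (k + 1)) ∞ T₂)
    {Φ : F × EuclideanSpace ℝ (Fin c) → F × EuclideanSpace ℝ (Fin c)}
    (hΦ : ContMDiffOn ((𝓡 d).prod (𝓡 c)) ((𝓡 d).prod (𝓡 c)) ∞ Φ {q | q.2 ≠ 0}) :
    ContMDiffOn (𝓡 (k + 1)) (𝓡 (k + 1)) ∞ (fun y : Y₁ => T₂ (Φ (invFun T₁ y)))
      (T₁ '' {q : F × EuclideanSpace ℝ (Fin c) | q.2 ≠ 0}) := by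
  have hinv : ContMDiffOn (𝓡 (k + 1)) ((𝓡 d).prod (𝓡 c)) ∞ (invFun T₁)
      (T₁ '' {q | q.2 ≠ 0}) :=
    (Literature.Geometry.Manifold.contMDiffOn_invFun_range hT).mono (image_subset_range _ _)
  refine (hT'.contMDiff.comp_contMDiffOn hΦ).comp hinv ?_
  rintro _ ⟨q, hq, rfl⟩
  show invFun T₁ (T₁ q) ∈ {q : F × EuclideanSpace ℝ (Fin c) | q.2 ≠ 0}
  rw [leftInverse_invFun hT.isEmbedding.injective q]
  exact hq

/-- **The corestricted tube map is `C^∞` into an open piece.**  If `φ : Y₁ → A'` agrees, after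
the inclusion of the open set `A' ⊆ Y₂`, with `T₁ q ↦ T₂ (Φ q)` on the punctured unit tube
`T₁(F × (B(0,1) ∖ 0))`, then `φ` restricted to any open piece `A ⊆ Y₁` is `C^∞` there.
[folklore] -/
theorem contMDiffOn_corestrict_tubeMap [Nonempty F]
    (hT : Manifold.IsSmoothEmbedding ((𝓡 d).prod (𝓡 c)) (𝓡 (k + 1)) ∞ T₁)
    (hTo : IsOpen (range T₁))
    (hT' : Manifold.IsSmoothEmbedding ((𝓡 d).prod (𝓡 c)) (𝓡 (k + 1)) ∞ T₂)
    {Φ : F × EuclideanSpace ℝ (Fin c) → F × EuclideanSpace ℝ (Fin c)}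
    (hΦ : ContMDiffOn ((𝓡 d).prod (𝓡 c)) ((𝓡 d).prod (𝓡 c)) ∞ Φ {q | q.2 ≠ 0})
    (A : TopologicalSpace.Opens Y₁) (A' : TopologicalSpace.Opens Y₂) (φ : Y₁ → A')
    (hφ : ∀ q : F × EuclideanSpace ℝ (Fin c), q.2 ≠ 0 → ‖q.2‖ < 1 →
      (φ (T₁ q) : Y₂) = T₂ (Φ q)) :
    ContMDiffOn (𝓡 (k + 1)) (𝓡 (k + 1)) ∞ (fun a : A => φ a)
      {a : A | (a : Y₁) ∈ T₁ '' {q : F × EuclideanSpace ℝ (Fin c) | q.2 ≠ 0 ∧ ‖q.2‖ < 1}} := by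
  have hopen : IsOpen (T₁ '' {q : F × EuclideanSpace ℝ (Fin c) | q.2 ≠ 0 ∧ ‖q.2‖ < 1}) :=
    isOpen_image_puncturedTube ⟨hT.isEmbedding, hTo⟩
  intro a ha
  refine (contMDiffAt_subtype_iff.2 ?_).contMDiffWithinAt
  rw [← ContMDiffAt.subtypeVal_comp_iff]
  have hev : (Subtype.val ∘ φ) =ᶠ[𝓝 (a : Y₁)] fun y : Y₁ => T₂ (Φ (invFun T₁ y)) := by
    filter_upwards [hopen.mem_nhds ha]
    rintro _ ⟨q, hq, rfl⟩
    simp only [Function.comp_apply]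
    rw [hφ q hq.1 hq.2, leftInverse_invFun hT.isEmbedding.injective q]
  refine ContMDiffAt.congr_of_eventuallyEq ?_ hev
  exact (contMDiffOn_tubeMap hT hT' hΦ).contMDiffAt
    ((isOpen_image_ne_zero ⟨hT.isEmbedding, hTo⟩).mem_nhds (image_mono (fun q hq => hq.1) ha))

/-- The closed tube `T(F × B̄(0, r))` over a compact `F` is compact. [folklore] -/
theorem isCompact_image_norm_le [CompactSpace F] (hT : Continuous T₁) (r : ℝ) :
    IsCompact (T₁ '' {q : F × EuclideanSpace ℝ (Fin c) | ‖q.2‖ ≤ r}) := by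
  have : {q : F × EuclideanSpace ℝ (Fin c) | ‖q.2‖ ≤ r} = univ ×ˢ closedBall 0 r := by
    ext q; simp [mem_closedBall, dist_zero_right]
  rw [this]
  exact (isCompact_univ.prod (isCompact_closedBall _ _)).image hT

/-- The trace `{b ∈ B | b ∈ T(F × B̄(0, ½))}` of the closed half tube on an open piece
`B ⊇ T(F × B̄(0, ½))` is compact (`F` compact). [folklore] -/
theorem isCompact_preimage_closedTube [CompactSpace F] (hT : Continuous T₁)
    (B : TopologicalSpace.Opens Y₁)
    (hB : T₁ '' {q : F × EuclideanSpace ℝ (Fin c) | ‖q.2‖ ≤ 1 / 2} ⊆ (B : Set Y₁)) :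
    IsCompact {b : B | (b : Y₁) ∈ T₁ '' {q : F × EuclideanSpace ℝ (Fin c) | ‖q.2‖ ≤ 1 / 2}} :=
  Topology.IsInducing.subtypeVal.isCompact_preimage' (isCompact_image_norm_le hT (1 / 2))
    fun x hx => ⟨⟨x, hB hx⟩, rfl⟩

/-- **The graph of the regluing is closed in `A × B`.**  For the open pieces `A = Y ∖ T(F × 0)`
and `B = T(F × B(0, 1))`, a fibred regluing map `Ψ` (`C^∞` on `F × Sᶜ⁻¹`, conical) and any map
`φ' : B → A` which agrees with `T q ↦ T (Ψ q)` on the punctured unit tube, the set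
`{(φ' b, b) | b ∈ T(F × (B ∖ 0))}` is closed in `A × B`: it is the trace on `A × B` of the compact
set `{(T((Ψ(f, u)).1, t (Ψ(f, u)).2), T(f, t u))}`, `f ∈ F`, `‖u‖ = 1`, `t ∈ [0, 1]`, whose extra
points (`t = 0`: on the removed core; `t = 1`: on the sphere bundle of radius `1`, outside `B`) lie
outside `A × B` (Kosinski VI.1: the Hausdorff condition for the pushout). [folklore] -/
theorem isClosed_graph_reglue [CompactSpace F] [T2Space Y₁] (hT : Topology.IsEmbedding T₁)
    {Ψ : F × EuclideanSpace ℝ (Fin c) → F × EuclideanSpace ℝ (Fin c)}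
    (hΨc : ContinuousOn Ψ {q | q.2 ≠ 0})
    (hcone : ∀ (f : F) (u : EuclideanSpace ℝ (Fin c)), ‖u‖ = 1 → ∀ t : ℝ, 0 < t →
      Ψ (f, t • u) = ((Ψ (f, u)).1, t • (Ψ (f, u)).2))
    (A B : TopologicalSpace.Opens Y₁)
    (hA : (A : Set Y₁) = (range fun f : F => T₁ (f, 0))ᶜ)
    (hB : (B : Set Y₁) = T₁ '' {q : F × EuclideanSpace ℝ (Fin c) | ‖q.2‖ < 1})
    (φ' : B → A)
    (hφ' : ∀ (b : B) (q : F × EuclideanSpace ℝ (Fin c)), q.2 ≠ 0 → ‖q.2‖ < 1 → (b : Y₁) = T₁ q →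
      (φ' b : Y₁) = T₁ (Ψ q)) :
    IsClosed {p : A × B |
      (p.2 : Y₁) ∈ T₁ '' {q : F × EuclideanSpace ℝ (Fin c) | q.2 ≠ 0 ∧ ‖q.2‖ < 1} ∧
        φ' p.2 = p.1} := by
  have hi : Injective T₁ := hT.injective
  -- the parametrisation of the closure of the graph
  have hΨs : Continuous fun r : F × (sphere (0 : EuclideanSpace ℝ (Fin c)) 1) =>
      Ψ (r.1, (r.2 : EuclideanSpace ℝ (Fin c))) := by
    refine hΨc.comp_continuous (by fun_prop) fun r => ?_
    show ((r.2 : EuclideanSpace ℝ (Fin c))) ≠ 0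
    exact ne_zero_of_mem_unit_sphere r.2
  have hpar : Continuous fun r : F × (sphere (0 : EuclideanSpace ℝ (Fin c)) 1) × (Icc (0 : ℝ) 1) =>
      ((T₁ ((Ψ (r.1, (r.2.1 : EuclideanSpace ℝ (Fin c)))).1,
          (r.2.2 : ℝ) • (Ψ (r.1, (r.2.1 : EuclideanSpace ℝ (Fin c)))).2),
        T₁ (r.1, (r.2.2 : ℝ) • (r.2.1 : EuclideanSpace ℝ (Fin c)))) : Y₁ × Y₁) := by
    have hT₁c := hT.continuous
    have h1 : Continuous fun r : F × (sphere (0 : EuclideanSpace ℝ (Fin c)) 1) × (Icc (0 : ℝ) 1) =>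
        Ψ (r.1, (r.2.1 : EuclideanSpace ℝ (Fin c))) :=
      hΨs.comp (continuous_fst.prodMk (continuous_fst.comp continuous_snd))
    have ht : Continuous fun r : F × (sphere (0 : EuclideanSpace ℝ (Fin c)) 1) × (Icc (0 : ℝ) 1) =>
        (r.2.2 : ℝ) := continuous_subtype_val.comp (continuous_snd.comp continuous_snd)
    have hu : Continuous fun r : F × (sphere (0 : EuclideanSpace ℝ (Fin c)) 1) × (Icc (0 : ℝ) 1) =>
        (r.2.1 : EuclideanSpace ℝ (Fin c)) :=
      continuous_subtype_val.comp (continuous_fst.comp continuous_snd)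
    exact (hT₁c.comp ((continuous_fst.comp h1).prodMk (ht.smul (continuous_snd.comp h1)))).prodMk
      (hT₁c.comp (continuous_fst.prodMk (ht.smul hu)))
  have hc : IsClosed (range fun r : F × (sphere (0 : EuclideanSpace ℝ (Fin c)) 1) ×
      (Icc (0 : ℝ) 1) =>
      ((T₁ ((Ψ (r.1, (r.2.1 : EuclideanSpace ℝ (Fin c)))).1,
          (r.2.2 : ℝ) • (Ψ (r.1, (r.2.1 : EuclideanSpace ℝ (Fin c)))).2),
        T₁ (r.1, (r.2.2 : ℝ) • (r.2.1 : EuclideanSpace ℝ (Fin c)))) : Y₁ × Y₁)) :=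
    (isCompact_range hpar).isClosed
  have hcont : Continuous fun p : A × B => (((p.1 : Y₁), (p.2 : Y₁)) : Y₁ × Y₁) := by fun_prop
  convert hc.preimage hcont using 1
  ext ⟨a, b⟩
  simp only [mem_setOf_eq, mem_preimage, mem_range]
  constructor
  · rintro ⟨⟨q, ⟨hq0, hq1⟩, hqb⟩, hab⟩
    have hφa := hφ' b q hq0 hq1 hqb.symm
    have hu := inv_norm_smul_mem_sphere hq0
    refine ⟨(q.1, ⟨‖q.2‖⁻¹ • q.2, hu⟩, ⟨‖q.2‖, norm_nonneg _, hq1.le⟩), ?_⟩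
    have hq' : q = (q.1, ‖q.2‖ • (‖q.2‖⁻¹ • q.2)) := by rw [norm_smul_inv_norm_smul hq0]
    simp only [Prod.mk.injEq]
    refine ⟨?_, ?_⟩
    · rw [← hab, hφa, ← hcone q.1 _ (mem_sphere_zero_iff_norm.1 hu) _ (norm_pos_iff.2 hq0), ← hq']
    · rw [norm_smul_inv_norm_smul hq0]; exact hqb
  · rintro ⟨⟨f, u, t, ht0, ht1⟩, h⟩
    simp only [Prod.mk.injEq] at h
    obtain ⟨ha, hb⟩ := h
    have hu : ‖(u : EuclideanSpace ℝ (Fin c))‖ = 1 := mem_sphere_zero_iff_norm.1 u.2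
    have ht0' : 0 < t := by
      rcases ht0.lt_or_eq with h | rfl
      · exact h
      · exfalso
        have hmem : (a : Y₁) ∈ (A : Set Y₁) := a.2
        rw [hA] at hmem
        exact hmem ⟨(Ψ (f, (u : EuclideanSpace ℝ (Fin c)))).1, by rw [← ha]; simp⟩
    have ht1' : t < 1 := by
      rcases ht1.lt_or_eq with h | rfl
      · exact h
      · exfalso
        have hmem : (b : Y₁) ∈ (B : Set Y₁) := b.2
        rw [hB, ← hb] at hmem
        obtain ⟨q, hq, hqe⟩ := hmem
        have := congrArg (fun p : F × EuclideanSpace ℝ (Fin c) => ‖p.2‖) (hi hqe)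
        dsimp only at this
        rw [one_smul, hu] at this
        have hq' : ‖q.2‖ < 1 := hq
        linarith
    have hv0 : t • (u : EuclideanSpace ℝ (Fin c)) ≠ 0 := by
      rw [← norm_ne_zero_iff, norm_smul, hu, mul_one, Real.norm_of_nonneg ht0]
      exact ht0'.ne'
    have hnv : ‖t • (u : EuclideanSpace ℝ (Fin c))‖ = t := by
      rw [norm_smul, hu, mul_one, Real.norm_of_nonneg ht0]
    have hv1 : ‖t • (u : EuclideanSpace ℝ (Fin c))‖ < 1 := by rw [hnv]; exact ht1'
    refine ⟨⟨(f, t • (u : EuclideanSpace ℝ (Fin c))), ⟨hv0, hv1⟩, hb⟩, ?_⟩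
    ext1
    rw [hφ' b (f, t • (u : EuclideanSpace ℝ (Fin c))) hv0 hv1 hb.symm, ← ha,
      hcone f _ hu t ht0']

end Lemmas

/-! ### §2 The open gluing datum of a regluing -/

section GlueData

variable {k d c : ℕ}
  {Y : Type} [TopologicalSpace Y] [ChartedSpace (EuclideanSpace ℝ (Fin (k + 1))) Y]
  {F : Type} [TopologicalSpace F] [ChartedSpace (EuclideanSpace ℝ (Fin d)) F]
  {T : F × EuclideanSpace ℝ (Fin c) → Y}
  {Ψ Ψ' : F × EuclideanSpace ℝ (Fin c) → F × EuclideanSpace ℝ (Fin c)}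

/-- **The open gluing datum of a tube regluing.**  Let `T : F × ℝᶜ → Y` be a smooth open
embedding (`F` compact, `Y` closed), `A = Y ∖ T(F × 0)` the complement of the core and
`B = T(F × B(0, 1))` the open unit tube, open submanifolds of `Y`, and `Ψ`, `Ψ'` mutually inverse
fibred regluing maps of `F × (ℝᶜ ∖ 0)` (`C^∞` there, radius preserving, `Ψ` conical).  There is a
gluing datum `D : SmoothGlueData (𝓡 _) (𝓡 _) A B ℝᵏ⁺¹` (`GluingConstruction.lean`) whose gluing
map is `T q ↦ T (Ψ' q)` from the punctured unit tube of `A` onto that of `B`, with inverse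
`T q ↦ T (Ψ q)` — the new point `T q` of the tube is attached to the old point `T(Ψ q)` — and
whose glued space `A ∪_D B`, **the manifold `Y` with the tube `T` reglued by `Ψ`**, is Hausdorff,
compact and second countable (Gompf–Stipsicz 1999, §8.3: `X_K = (X ∖ νT) ∪_φ (T² × D²)`;
Kosinski 1993, VI.1). [cite: GompfStipsiczGSM1999, §8.3 p. 311] -/
theorem exists_smoothGlueData_reglue [Nonempty F] [CompactSpace F] [T2Space Y] [CompactSpace Y]
    [IsManifold (𝓡 (k + 1)) ∞ Y] (hc : 0 < c)
    (hT : Manifold.IsSmoothEmbedding ((𝓡 d).prod (𝓡 c)) (𝓡 (k + 1)) ∞ T)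
    (hTo : IsOpen (range T))
    (hΨ : ContMDiffOn ((𝓡 d).prod (𝓡 c)) ((𝓡 d).prod (𝓡 c)) ∞ Ψ {q | q.2 ≠ 0})
    (hΨ' : ContMDiffOn ((𝓡 d).prod (𝓡 c)) ((𝓡 d).prod (𝓡 c)) ∞ Ψ' {q | q.2 ≠ 0})
    (hΨΨ' : ∀ q : F × EuclideanSpace ℝ (Fin c), q.2 ≠ 0 → Ψ (Ψ' q) = q)
    (hΨ'Ψ : ∀ q : F × EuclideanSpace ℝ (Fin c), q.2 ≠ 0 → Ψ' (Ψ q) = q)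
    (hnΨ : ∀ q : F × EuclideanSpace ℝ (Fin c), q.2 ≠ 0 → ‖(Ψ q).2‖ = ‖q.2‖)
    (hnΨ' : ∀ q : F × EuclideanSpace ℝ (Fin c), q.2 ≠ 0 → ‖(Ψ' q).2‖ = ‖q.2‖)
    (hcone : ∀ (f : F) (u : EuclideanSpace ℝ (Fin c)), ‖u‖ = 1 → ∀ t : ℝ, 0 < t →
      Ψ (f, t • u) = ((Ψ (f, u)).1, t • (Ψ (f, u)).2))
    (A B : TopologicalSpace.Opens Y)
    (hA : (A : Set Y) = (range fun f : F => T (f, 0))ᶜ)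
    (hB : (B : Set Y) = T '' {q : F × EuclideanSpace ℝ (Fin c) | ‖q.2‖ < 1}) :
    ∃ D : SmoothGlueData (𝓡 (k + 1)) (𝓡 (k + 1)) A B (EuclideanSpace ℝ (Fin (k + 1))),
      D.glue.source =
          {a : A | (a : Y) ∈ T '' {q : F × EuclideanSpace ℝ (Fin c) | q.2 ≠ 0 ∧ ‖q.2‖ < 1}} ∧
      D.glue.target =
          {b : B | (b : Y) ∈ T '' {q : F × EuclideanSpace ℝ (Fin c) | q.2 ≠ 0 ∧ ‖q.2‖ < 1}} ∧
      (∀ (a : A) (q : F × EuclideanSpace ℝ (Fin c)), q.2 ≠ 0 → ‖q.2‖ < 1 → (a : Y) = T q →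
        (D.glue a : Y) = T (Ψ' q)) ∧
      (∀ (b : B) (q : F × EuclideanSpace ℝ (Fin c)), q.2 ≠ 0 → ‖q.2‖ < 1 → (b : Y) = T q →
        (D.glue.symm b : Y) = T (Ψ q)) ∧
      T2Space D.Glued ∧ CompactSpace D.Glued ∧ SecondCountableTopology D.Glued := by
  classical
  have hi : Injective T := hT.isEmbedding.injective
  have hoe : Topology.IsOpenEmbedding T := ⟨hT.isEmbedding, hTo⟩
  -- membership in the pieces
  have hmemA : ∀ q : F × EuclideanSpace ℝ (Fin c), T q ∈ A ↔ q.2 ≠ 0 := fun q => by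
    rw [← SetLike.mem_coe, hA, mem_compl_iff, apply_mem_range_core_iff hi]
  have hmemB : ∀ q : F × EuclideanSpace ℝ (Fin c), T q ∈ B ↔ ‖q.2‖ < 1 := fun q => by
    rw [← SetLike.mem_coe, hB, hi.mem_set_image]
    rfl
  -- the punctured unit tube and its stability under `Ψ`, `Ψ'`
  set U : Set (F × EuclideanSpace ℝ (Fin c)) := {q | q.2 ≠ 0 ∧ ‖q.2‖ < 1} with hU
  have hne : ∀ q : F × EuclideanSpace ℝ (Fin c), q.2 ≠ 0 → (Ψ q).2 ≠ 0 := fun q hq => by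
    rw [← norm_ne_zero_iff, hnΨ q hq, norm_ne_zero_iff]; exact hq
  have hne' : ∀ q : F × EuclideanSpace ℝ (Fin c), q.2 ≠ 0 → (Ψ' q).2 ≠ 0 := fun q hq => by
    rw [← norm_ne_zero_iff, hnΨ' q hq, norm_ne_zero_iff]; exact hq
  have hΨU : ∀ q ∈ U, Ψ q ∈ U := fun q hq =>
    ⟨hne q hq.1, by rw [hnΨ q hq.1]; exact hq.2⟩
  have hΨ'U : ∀ q ∈ U, Ψ' q ∈ U := fun q hq =>
    ⟨hne' q hq.1, by rw [hnΨ' q hq.1]; exact hq.2⟩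
  -- base points (junk values): `T (f₀, v₀)` off the core, `T (f₀, 0)` in the unit tube
  haveI : Nontrivial (EuclideanSpace ℝ (Fin c)) :=
    Module.nontrivial_of_finrank_pos (R := ℝ) (by rw [finrank_euclideanSpace_fin]; exact hc)
  obtain ⟨v₀, hv₀0⟩ := exists_ne (0 : EuclideanSpace ℝ (Fin c))
  set f₀ : F := Classical.arbitrary F
  let a₀ : A := ⟨T (f₀, v₀), (hmemA _).2 hv₀0⟩
  let b₀ : B := ⟨T (f₀, 0), (hmemB _).2 (by simp)⟩
  -- the two corestricted tube maps
  let φ : Y → B := fun y => if h : T (Ψ' (invFun T y)) ∈ B then ⟨_, h⟩ else b₀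
  let φ' : Y → A := fun y => if h : T (Ψ (invFun T y)) ∈ A then ⟨_, h⟩ else a₀
  have hφ : ∀ q : F × EuclideanSpace ℝ (Fin c), q.2 ≠ 0 → ‖q.2‖ < 1 →
      (φ (T q) : Y) = T (Ψ' q) := by
    intro q hq0 hq1
    have hmem : T (Ψ' (invFun T (T q))) ∈ B := by
      rw [leftInverse_invFun hi q, hmemB, hnΨ' q hq0]
      exact hq1
    simp only [φ, dif_pos hmem]
    rw [leftInverse_invFun hi q]
  have hφ' : ∀ q : F × EuclideanSpace ℝ (Fin c), q.2 ≠ 0 → ‖q.2‖ < 1 →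
      (φ' (T q) : Y) = T (Ψ q) := by
    intro q hq0 hq1
    have hmem : T (Ψ (invFun T (T q))) ∈ A := by
      rw [leftInverse_invFun hi q, hmemA]
      exact hne q hq0
    simp only [φ', dif_pos hmem]
    rw [leftInverse_invFun hi q]
  -- the gluing map
  let G : OpenPartialHomeomorph A B :=
  { toFun := fun a => φ a
    invFun := fun b => φ' b
    source := {a : A | (a : Y) ∈ T '' U}
    target := {b : B | (b : Y) ∈ T '' U}
    map_source' := by
      rintro a ⟨q, hq, hqa⟩
      show (φ a : Y) ∈ T '' U
      rw [← hqa, hφ q hq.1 hq.2]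
      exact ⟨_, hΨ'U q hq, rfl⟩
    map_target' := by
      rintro b ⟨q, hq, hqb⟩
      show (φ' b : Y) ∈ T '' U
      rw [← hqb, hφ' q hq.1 hq.2]
      exact ⟨_, hΨU q hq, rfl⟩
    left_inv' := by
      rintro a ⟨q, hq, hqa⟩
      ext1
      show (φ' (φ a) : Y) = a
      rw [← hqa, hφ q hq.1 hq.2, hφ' _ (hΨ'U q hq).1 (hΨ'U q hq).2, hΨΨ' q hq.1]
    right_inv' := by
      rintro b ⟨q, hq, hqb⟩
      ext1
      show (φ (φ' b) : Y) = b
      rw [← hqb, hφ' q hq.1 hq.2, hφ _ (hΨU q hq).1 (hΨU q hq).2, hΨ'Ψ q hq.1]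
    open_source := (isOpen_image_puncturedTube hoe).preimage continuous_subtype_val
    open_target := (isOpen_image_puncturedTube hoe).preimage continuous_subtype_val
    continuousOn_toFun :=
      (contMDiffOn_corestrict_tubeMap hT hTo hT hΨ' A B φ hφ).continuousOn
    continuousOn_invFun :=
      (contMDiffOn_corestrict_tubeMap hT hTo hT hΨ B A φ' hφ').continuousOn }
  let D : SmoothGlueData (𝓡 (k + 1)) (𝓡 (k + 1)) A B (EuclideanSpace ℝ (Fin (k + 1))) :=
  { glue := G
    contMDiffOn_glue := contMDiffOn_corestrict_tubeMap hT hTo hT hΨ' A B φ hφ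
    contMDiffOn_glue_symm := contMDiffOn_corestrict_tubeMap hT hTo hT hΨ B A φ' hφ'
    linA := ContinuousLinearEquiv.refl ℝ _
    linB := ContinuousLinearEquiv.refl ℝ _ }
  have hglue : ∀ (a : A) (q : F × EuclideanSpace ℝ (Fin c)), q.2 ≠ 0 → ‖q.2‖ < 1 →
      (a : Y) = T q → (D.glue a : Y) = T (Ψ' q) := by
    intro a q hq0 hq1 hqa
    show (φ a : Y) = _
    rw [hqa]
    exact hφ q hq0 hq1
  have hglue' : ∀ (b : B) (q : F × EuclideanSpace ℝ (Fin c)), q.2 ≠ 0 → ‖q.2‖ < 1 →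
      (b : Y) = T q → (D.glue.symm b : Y) = T (Ψ q) := by
    intro b q hq0 hq1 hqb
    show (φ' b : Y) = _
    rw [hqb]
    exact hφ' q hq0 hq1
  -- Hausdorff: the graph of `glue.symm` (equivalently of `glue`) is closed
  have hT2 : T2Space D.Glued := by
    refine D.t2Space_of_isClosed_graph ?_
    have hcl := isClosed_graph_reglue hT.isEmbedding hΨ.continuousOn hcone A B hA hB (fun b => φ' b)
      (fun b q hq0 hq1 hqb => by
        show (φ' b : Y) = T (Ψ q)
        rw [hqb]
        exact hφ' q hq0 hq1)
    convert hcl using 1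
    ext ⟨a, b⟩
    simp only [mem_setOf_eq]
    constructor
    · rintro ⟨ha, hab⟩
      have hb : b ∈ D.glue.target := by rw [← hab]; exact D.glue.map_source ha
      refine ⟨hb, ?_⟩
      show D.glue.symm b = a
      rw [← hab, D.glue.left_inv ha]
    · rintro ⟨hb, hba⟩
      have ha : a ∈ D.glue.source := by
        have : D.glue.symm b ∈ D.glue.source := D.glue.map_target hb
        rwa [show D.glue.symm b = a from hba] at this
      refine ⟨ha, ?_⟩
      rw [← show D.glue.symm b = a from hba, D.glue.right_inv hb]
  -- compact: the images of `Y ∖ T(F × B(0, ½))` and `T(F × B̄(0, ½))` cover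
  have hsubA : (T '' {q : F × EuclideanSpace ℝ (Fin c) | ‖q.2‖ < 1 / 2})ᶜ ⊆ (A : Set Y) := by
    rw [hA]
    refine compl_subset_compl.2 ?_
    rintro _ ⟨f, rfl⟩
    exact ⟨(f, 0), by norm_num, rfl⟩
  have hsubB : T '' {q : F × EuclideanSpace ℝ (Fin c) | ‖q.2‖ ≤ 1 / 2} ⊆ (B : Set Y) := by
    rw [hB]
    rintro _ ⟨q, hq, rfl⟩
    have hq' : ‖q.2‖ ≤ 1 / 2 := hq
    exact ⟨q, show ‖q.2‖ < 1 by linarith, rfl⟩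
  have hcpt : CompactSpace D.Glued := by
    refine D.compactSpace_of_forall_not_mem (isCompact_preimage_compl_halfTube hoe A hsubA)
      (isCompact_preimage_closedTube hT.isEmbedding.continuous B hsubB) ?_ ?_
    · intro a ha
      simp only [mem_setOf_eq, not_not] at ha
      obtain ⟨q, hq, hqa⟩ := ha
      have hq' : ‖q.2‖ < 1 / 2 := hq
      have hq0 : q.2 ≠ 0 := (hmemA q).1 (hqa ▸ a.2)
      have hq1 : ‖q.2‖ < 1 := hq'.trans (by norm_num)
      refine ⟨⟨q, ⟨hq0, hq1⟩, hqa⟩, ?_⟩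
      show (D.glue a : Y) ∈ T '' {q : F × EuclideanSpace ℝ (Fin c) | ‖q.2‖ ≤ 1 / 2}
      rw [hglue a q hq0 hq1 hqa.symm]
      exact ⟨Ψ' q, show ‖(Ψ' q).2‖ ≤ 1 / 2 by rw [hnΨ' q hq0]; exact hq'.le, rfl⟩
    · intro b hb
      have hbB : (b : Y) ∈ (B : Set Y) := b.2
      rw [hB] at hbB
      obtain ⟨q, hq1, hqb⟩ := hbB
      have hq1' : ‖q.2‖ < 1 := hq1
      have hq : ¬ ‖q.2‖ ≤ 1 / 2 := by
        intro hle
        exact hb ⟨q, hle, hqb⟩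
      rw [not_le] at hq
      have hq0 : q.2 ≠ 0 := by
        rw [← norm_pos_iff]; exact hq.trans' (by norm_num)
      refine ⟨⟨q, ⟨hq0, hq1'⟩, hqb⟩, ?_⟩
      show (D.glue.symm b : Y) ∉ T '' {q : F × EuclideanSpace ℝ (Fin c) | ‖q.2‖ < 1 / 2}
      rw [hglue' b q hq0 hq1' hqb.symm]
      rintro ⟨q', hq'', he⟩
      have := congrArg (fun p : F × EuclideanSpace ℝ (Fin c) => ‖p.2‖) (hi he)
      simp only [hnΨ q hq0] at this
      have : ‖q'.2‖ < 1 / 2 := hq''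
      linarith
  haveI := hcpt
  exact ⟨D, rfl, rfl, hglue, hglue', hT2, hcpt, D.secondCountableTopology⟩

end GlueData

/-! ### §3 The surgery as a boundary regluing of the tube piece to the complement -/

section Surgery

variable {k d c : ℕ}
  {Y : Type} [TopologicalSpace Y] [T2Space Y] [ChartedSpace (EuclideanSpace ℝ (Fin (k + 1))) Y]
  [IsManifold (𝓡 (k + 1)) ∞ Y] [CompactSpace Y]
  {F : Type} [TopologicalSpace F] [CompactSpace F] [Nonempty F]
  [ChartedSpace (EuclideanSpace ℝ (Fin d)) F]
  {T : F × EuclideanSpace ℝ (Fin c) → Y} {g : Y → ℝ}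
  {Ψ Ψ' : F × EuclideanSpace ℝ (Fin c) → F × EuclideanSpace ℝ (Fin c)}

/-- **Torus surgery exists (surgery along a tube by a fibred regluing), as a boundary regluing
of the tube piece to the tube complement.**  Let `T : F × ℝᶜ → Y` be a smooth open embedding
(`F` compact, `Y` closed, `c ≥ 1`) with a tube function `g` (regular level `¼`,
`{g ∘ T ≤ ¼} = {‖v‖ ≤ ½}`, `{g ∘ T < ¼} = {‖v‖ < ½}`, `g ≡ 1` off the tube; `exists_tube_function`),
and `Ψ`, `Ψ'` mutually inverse fibred regluing maps of `F × (ℝᶜ ∖ 0)`: `C^∞` off the zero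
section, radius preserving, `Ψ` conical.  Then there are a closed (compact, Hausdorff, second
countable) smooth `(k+1)`-manifold `P` — `Y` with the tube reglued by `Ψ`, §2 — a bijection `φ'`
from the boundary `∂{¼ ≤ g} = T(F × S(0, ½))` of the tube complement to the boundary `∂{g ≤ ¼}`
of the tube piece given by `φ'(T q) = T(Ψ' q)`, gluing data
`GP : BoundaryGluingData (boundaryData _) (boundaryData _) φ' P` exhibiting `P` as the regluing
`{¼ ≤ g} ∪_{φ'} {g ≤ ¼}` (the hypothesis `GP` of
`Literature.Barriers.SmoothPoincare4.akhmedovPark2010_lemma8_block_of_tube_regluing` and of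
`exists_signature_eq_of_tube_regluing`, `isOrientableOver_int_of_tube_regluing`,
`relEuler_eq_of_tube_regluing`, `exists_tube_transport`), and the two open smooth embeddings
`ι : Y ∖ T(F × 0) → P`, `ι' : T(F × B(0,1)) → P` of the construction, covering `P`, with
`jA = ι ∘ incl`, `jB = ι' ∘ incl` and `ι a = ι' b ↔ b = T q ∧ a = T (Ψ q)` (`0 < ‖q.2‖ < 1`):
tubes of `Y` off the core are carried to smooth tubes `ι ∘ T₀` of `P`.  Gompf–Stipsicz 1999,
§8.3 p. 311 ("`X_K = (X ∖ νT) ∪_φ (T² × D²)`, `φ : T³ → ∂νT`"); Akhmedov–Park 2010, §2.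
[cite: GompfStipsiczGSM1999, §8.3 p. 311] [cite: AkhmedovPark2010, §2] -/
theorem exists_tubeRegluing_boundaryGluingData (hc : 0 < c)
    (hT : Manifold.IsSmoothEmbedding ((𝓡 d).prod (𝓡 c)) (𝓡 (k + 1)) ∞ T)
    (hTo : IsOpen (range T))
    (hreg : IsRegularLevel (𝓡 (k + 1)) g (1 / 4))
    (hle : ∀ x, g (T x) ≤ 1 / 4 ↔ ‖x.2‖ ≤ 1 / 2) (hlt : ∀ x, g (T x) < 1 / 4 ↔ ‖x.2‖ < 1 / 2)
    (hout : ∀ y, y ∉ range T → g y = 1)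
    (hΨ : ContMDiffOn ((𝓡 d).prod (𝓡 c)) ((𝓡 d).prod (𝓡 c)) ∞ Ψ {q | q.2 ≠ 0})
    (hΨ' : ContMDiffOn ((𝓡 d).prod (𝓡 c)) ((𝓡 d).prod (𝓡 c)) ∞ Ψ' {q | q.2 ≠ 0})
    (hΨΨ' : ∀ q : F × EuclideanSpace ℝ (Fin c), q.2 ≠ 0 → Ψ (Ψ' q) = q)
    (hΨ'Ψ : ∀ q : F × EuclideanSpace ℝ (Fin c), q.2 ≠ 0 → Ψ' (Ψ q) = q)
    (hnΨ : ∀ q : F × EuclideanSpace ℝ (Fin c), q.2 ≠ 0 → ‖(Ψ q).2‖ = ‖q.2‖)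
    (hnΨ' : ∀ q : F × EuclideanSpace ℝ (Fin c), q.2 ≠ 0 → ‖(Ψ' q).2‖ = ‖q.2‖)
    (hcone : ∀ (f : F) (u : EuclideanSpace ℝ (Fin c)), ‖u‖ = 1 → ∀ t : ℝ, 0 < t →
      Ψ (f, t • u) = ((Ψ (f, u)).1, t • (Ψ (f, u)).2)) :
    ∃ (P : Type) (_ : TopologicalSpace P) (_ : T2Space P) (_ : SecondCountableTopology P)
      (_ : CompactSpace P) (_ : ChartedSpace (EuclideanSpace ℝ (Fin (k + 1))) P)
      (_ : IsManifold (𝓡 (k + 1)) ∞ P)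
      (φ' : (RegularSublevel.boundaryData hreg.const_sub).carrier ≃
        (RegularSublevel.boundaryData hreg).carrier)
      (GP : BoundaryGluingData (RegularSublevel.boundaryData hreg.const_sub)
        (RegularSublevel.boundaryData hreg) φ' P)
      (A B : TopologicalSpace.Opens Y)
      (hA : ∀ p : RegularSuperlevel hreg, RegularSublevel.incl hreg.const_sub p ∈ A)
      (hB : ∀ p : RegularSublevel hreg, RegularSublevel.incl hreg p ∈ B)
      (ι : A → P) (ι' : B → P),
      (A : Set Y) = (range fun f : F => T (f, 0))ᶜ ∧
      (B : Set Y) = T '' {q : F × EuclideanSpace ℝ (Fin c) | ‖q.2‖ < 1} ∧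
      (∀ (z : (RegularSublevel.boundaryData hreg.const_sub).carrier)
        (q : F × EuclideanSpace ℝ (Fin c)),
        RegularSublevel.incl hreg.const_sub z.1 = T q →
          RegularSublevel.incl hreg (φ' z).1 = T (Ψ' q)) ∧
      Manifold.IsSmoothEmbedding (𝓡 (k + 1)) (𝓡 (k + 1)) ∞ ι ∧ IsOpen (range ι) ∧
      Manifold.IsSmoothEmbedding (𝓡 (k + 1)) (𝓡 (k + 1)) ∞ ι' ∧ IsOpen (range ι') ∧
      range ι ∪ range ι' = univ ∧
      (∀ p, GP.jA p = ι ⟨RegularSublevel.incl hreg.const_sub p, hA p⟩) ∧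
      (∀ p, GP.jB p = ι' ⟨RegularSublevel.incl hreg p, hB p⟩) ∧
      (∀ a b, ι a = ι' b ↔ ∃ q : F × EuclideanSpace ℝ (Fin c), q.2 ≠ 0 ∧ ‖q.2‖ < 1 ∧
        (b : Y) = T q ∧ (a : Y) = T (Ψ q)) := by
  classical
  have hi : Injective T := hT.isEmbedding.injective
  -- the open pieces and the gluing datum of §2
  let A : TopologicalSpace.Opens Y :=
    ⟨(range fun f : F => T (f, 0))ᶜ, isOpen_compl_range_core hT.isEmbedding.continuous⟩
  let B : TopologicalSpace.Opens Y :=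
    ⟨T '' {q : F × EuclideanSpace ℝ (Fin c) | ‖q.2‖ < 1},
      isOpen_image_norm_lt ⟨hT.isEmbedding, hTo⟩ 1⟩
  obtain ⟨D, hsrc, htgt, hglue, hglue', hT2, hcpt, hsc⟩ :=
    exists_smoothGlueData_reglue hc hT hTo hΨ hΨ' hΨΨ' hΨ'Ψ hnΨ hnΨ' hcone A B rfl rfl
  haveI := hT2
  haveI := hcpt
  haveI := hsc
  have hmemA : ∀ q : F × EuclideanSpace ℝ (Fin c), T q ∈ A ↔ q.2 ≠ 0 := fun q => by
    show T q ∈ (range fun f : F => T (f, 0))ᶜ ↔ _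
    rw [mem_compl_iff, apply_mem_range_core_iff hi]
  have hmemB : ∀ q : F × EuclideanSpace ℝ (Fin c), T q ∈ B ↔ ‖q.2‖ < 1 := fun q => by
    show T q ∈ T '' {q : F × EuclideanSpace ℝ (Fin c) | ‖q.2‖ < 1} ↔ _
    rw [hi.mem_set_image]
    rfl
  have hne' : ∀ q : F × EuclideanSpace ℝ (Fin c), q.2 ≠ 0 → (Ψ' q).2 ≠ 0 := fun q hq => by
    rw [← norm_ne_zero_iff, hnΨ' q hq, norm_ne_zero_iff]; exact hq
  -- the two pieces `M = {¼ ≤ g}` (complement) and `N = {g ≤ ¼}` (tube piece)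
  set hM := hreg.const_sub with hhM
  have hsupM : ∀ p : RegularSuperlevel hreg, 1 / 4 ≤ g (RegularSublevel.incl hM p) := fun p =>
    sub_nonpos.1 (RegularSublevel.apply_incl_le hM p)
  have hsubN : ∀ p : RegularSublevel hreg, g (RegularSublevel.incl hreg p) ≤ 1 / 4 := fun p =>
    RegularSublevel.apply_incl_le hreg p
  have hbdM : ∀ p : RegularSuperlevel hreg,
      p ∈ (𝓡∂ (k + 1)).boundary (RegularSuperlevel hreg) ↔
        g (RegularSublevel.incl hM p) = 1 / 4 := fun p => by
    rw [RegularSublevel.mem_boundary_iff]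
    change (1 / 4 : ℝ) - g (RegularSublevel.incl hM p) = 0 ↔ _
    rw [sub_eq_zero, eq_comm]
  have hbdN : ∀ p : RegularSublevel hreg,
      p ∈ (𝓡∂ (k + 1)).boundary (RegularSublevel hreg) ↔
        g (RegularSublevel.incl hreg p) = 1 / 4 := fun p => RegularSublevel.mem_boundary_iff hreg p
  -- points of the pieces lie in the open pieces
  have hinA : ∀ p : RegularSuperlevel hreg, RegularSublevel.incl hM p ∈ A := by
    intro p
    show RegularSublevel.incl hM p ∈ (range fun f : F => T (f, 0))ᶜ
    rintro ⟨f, hf⟩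
    have h := hsupM p
    rw [← hf] at h
    have : g (T (f, 0)) < 1 / 4 := (hlt (f, 0)).2 (by norm_num)
    linarith
  have hNq : ∀ p : RegularSublevel hreg, ∃ q : F × EuclideanSpace ℝ (Fin c),
      ‖q.2‖ ≤ 1 / 2 ∧ T q = RegularSublevel.incl hreg p := by
    intro p
    have hmem : RegularSublevel.incl hreg p ∈ g ⁻¹' Iic (1 / 4) := hsubN p
    rw [preimage_Iic_eq_image_tube hle hout] at hmem
    obtain ⟨q, hq, hqp⟩ := hmem
    exact ⟨q, hq, hqp⟩
  have hinB : ∀ p : RegularSublevel hreg, RegularSublevel.incl hreg p ∈ B := by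
    intro p
    obtain ⟨q, hq, hqp⟩ := hNq p
    rw [← hqp, hmemB]
    linarith
  -- the level sphere bundle: a boundary point is `T q` with `‖q.2‖ = ½`
  have hval : ∀ q : F × EuclideanSpace ℝ (Fin c), ‖q.2‖ = 1 / 2 → g (T q) = 1 / 4 := fun q hq =>
    le_antisymm ((hle q).2 hq.le) ((le_tubeFunction_apply_iff hlt q).2 hq.ge)
  have hlevM : ∀ z : (𝓡∂ (k + 1)).boundary (RegularSuperlevel hreg),
      ∃ q : F × EuclideanSpace ℝ (Fin c), ‖q.2‖ = 1 / 2 ∧ T q = RegularSublevel.incl hM z.1 := by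
    intro z
    have hz : g (RegularSublevel.incl hM z.1) = 1 / 4 := (hbdM z.1).1 z.2
    have hmem : RegularSublevel.incl hM z.1 ∈ g ⁻¹' {1 / 4} := hz
    rw [level_eq_image_tube hle hlt hout] at hmem
    obtain ⟨q, ⟨-, hq⟩, hqz⟩ := hmem
    exact ⟨q, mem_sphere_zero_iff_norm.1 hq, hqz⟩
  have hlevN : ∀ z : (𝓡∂ (k + 1)).boundary (RegularSublevel hreg),
      ∃ q : F × EuclideanSpace ℝ (Fin c), ‖q.2‖ = 1 / 2 ∧ T q = RegularSublevel.incl hreg z.1 := by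
    intro z
    have hz : g (RegularSublevel.incl hreg z.1) = 1 / 4 := (hbdN z.1).1 z.2
    have hmem : RegularSublevel.incl hreg z.1 ∈ g ⁻¹' {1 / 4} := hz
    rw [level_eq_image_tube hle hlt hout] at hmem
    obtain ⟨q, ⟨-, hq⟩, hqz⟩ := hmem
    exact ⟨q, mem_sphere_zero_iff_norm.1 hq, hqz⟩
  have hhalf0 : ∀ q : F × EuclideanSpace ℝ (Fin c), ‖q.2‖ = 1 / 2 → q.2 ≠ 0 := fun q hq => by
    rw [← norm_ne_zero_iff, hq]; norm_num
  -- the identification of the boundaries: `T q ↦ T (Ψ' q)`, inverse `T q ↦ T (Ψ q)`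
  let φf : (𝓡∂ (k + 1)).boundary (RegularSuperlevel hreg) →
      (𝓡∂ (k + 1)).boundary (RegularSublevel hreg) := fun z =>
    ⟨RegularSublevel.mk hreg (T (Ψ' (invFun T (RegularSublevel.incl hM z.1)))) (by
        obtain ⟨q, hq, hqz⟩ := hlevM z
        rw [← hqz, leftInverse_invFun hi q]
        exact (hval (Ψ' q) (by rw [hnΨ' q (hhalf0 q hq), hq])).le), by
        rw [hbdN]
        change g (T (Ψ' (invFun T (RegularSublevel.incl hM z.1)))) = 1 / 4
        obtain ⟨q, hq, hqz⟩ := hlevM z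
        rw [← hqz, leftInverse_invFun hi q]
        exact hval (Ψ' q) (by rw [hnΨ' q (hhalf0 q hq), hq])⟩
  let φb : (𝓡∂ (k + 1)).boundary (RegularSublevel hreg) →
      (𝓡∂ (k + 1)).boundary (RegularSuperlevel hreg) := fun z =>
    ⟨RegularSublevel.mk hM (T (Ψ (invFun T (RegularSublevel.incl hreg z.1)))) (by
        obtain ⟨q, hq, hqz⟩ := hlevN z
        rw [← hqz, leftInverse_invFun hi q]
        exact sub_nonpos.2 (hval (Ψ q) (by rw [hnΨ q (hhalf0 q hq), hq])).ge), by
        rw [hbdM]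
        change g (T (Ψ (invFun T (RegularSublevel.incl hreg z.1)))) = 1 / 4
        obtain ⟨q, hq, hqz⟩ := hlevN z
        rw [← hqz, leftInverse_invFun hi q]
        exact hval (Ψ q) (by rw [hnΨ q (hhalf0 q hq), hq])⟩
  have hφf_apply : ∀ z (q : F × EuclideanSpace ℝ (Fin c)), RegularSublevel.incl hM z.1 = T q →
      RegularSublevel.incl hreg (φf z).1 = T (Ψ' q) := by
    intro z q hzq
    show T (Ψ' (invFun T (RegularSublevel.incl hM z.1))) = T (Ψ' q)
    rw [hzq, leftInverse_invFun hi q]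
  have hφb_apply : ∀ z (q : F × EuclideanSpace ℝ (Fin c)), RegularSublevel.incl hreg z.1 = T q →
      RegularSublevel.incl hM (φb z).1 = T (Ψ q) := by
    intro z q hzq
    show T (Ψ (invFun T (RegularSublevel.incl hreg z.1))) = T (Ψ q)
    rw [hzq, leftInverse_invFun hi q]
  let φ' : (RegularSublevel.boundaryData hM).carrier ≃ (RegularSublevel.boundaryData hreg).carrier :=
  { toFun := φf
    invFun := φb
    left_inv := fun z => by
      obtain ⟨q, hq, hqz⟩ := hlevM z
      apply Subtype.ext
      apply RegularSublevel.injective_incl hM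
      rw [hφb_apply (φf z) (Ψ' q) (hφf_apply z q hqz.symm), hΨΨ' q (hhalf0 q hq), hqz]
    right_inv := fun z => by
      obtain ⟨q, hq, hqz⟩ := hlevN z
      apply Subtype.ext
      apply RegularSublevel.injective_incl hreg
      rw [hφf_apply (φb z) (Ψ q) (hφb_apply z q hqz.symm), hΨ'Ψ q (hhalf0 q hq), hqz] }
  -- the two embeddings
  let i₁ : RegularSuperlevel hreg → A := fun p => ⟨RegularSublevel.incl hM p, hinA p⟩
  let i₂ : RegularSublevel hreg → B := fun p => ⟨RegularSublevel.incl hreg p, hinB p⟩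
  have hi₁e : Manifold.IsSmoothEmbedding (𝓡∂ (k + 1)) (𝓡 (k + 1)) ∞ i₁ :=
    (RegularSublevel.isSmoothEmbedding_incl hM).opensCodRestrict A hinA
  have hi₂e : Manifold.IsSmoothEmbedding (𝓡∂ (k + 1)) (𝓡 (k + 1)) ∞ i₂ :=
    (RegularSublevel.isSmoothEmbedding_incl hreg).opensCodRestrict B hinB
  let GP : BoundaryGluingData (RegularSublevel.boundaryData hM) (RegularSublevel.boundaryData hreg)
      φ' D.Glued :=
  { jA := D.inl ∘ i₁
    jB := D.inr ∘ i₂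
    isSmoothEmbedding_jA := D.isSmoothEmbedding_inl_comp hi₁e
    isSmoothEmbedding_jB := D.isSmoothEmbedding_inr_comp hi₂e
    range_union := by
      apply eq_univ_of_forall
      intro x
      obtain (⟨a, rfl⟩ | ⟨b, rfl⟩) := D.exists_inl_or_inr x
      · by_cases ha : 1 / 4 ≤ g (a : Y)
        · refine Or.inl ⟨RegularSublevel.mk hM (a : Y) (sub_nonpos.2 ha), ?_⟩
          exact congrArg D.inl (Subtype.ext rfl)
        · -- `a = T q` with `0 < ‖q.2‖ < ½` is glued to `T (Ψ' q)`, `‖(Ψ' q).2‖ < ½`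
          rw [not_le] at ha
          obtain ⟨q, hqa⟩ := mem_range_of_tubeFunction_lt hout (ha.trans (by norm_num))
          have hq : ‖q.2‖ < 1 / 2 := (hlt q).1 (hqa ▸ ha)
          have hq0 : q.2 ≠ 0 := (hmemA q).1 (hqa ▸ a.2)
          have hq1 : ‖q.2‖ < 1 := hq.trans (by norm_num)
          have hsrc' : a ∈ D.glue.source := by
            rw [hsrc]; exact ⟨q, ⟨hq0, hq1⟩, hqa⟩
          have hgl : (D.glue a : Y) = T (Ψ' q) := hglue a q hq0 hq1 hqa.symm
          have hle' : g (D.glue a : Y) ≤ 1 / 4 := by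
            rw [hgl, hle, hnΨ' q hq0]
            exact hq.le
          refine Or.inr ⟨RegularSublevel.mk hreg (D.glue a : Y) hle', ?_⟩
          show D.inr (i₂ _) = D.inl a
          rw [← D.inr_glue hsrc']
          exact congrArg D.inr (Subtype.ext rfl)
      · by_cases hb : g (b : Y) ≤ 1 / 4
        · refine Or.inr ⟨RegularSublevel.mk hreg (b : Y) hb, ?_⟩
          exact congrArg D.inr (Subtype.ext rfl)
        · -- `b = T q` with `½ < ‖q.2‖ < 1` is glued to `T (Ψ q)`, `‖(Ψ q).2‖ > ½`
          rw [not_le] at hb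
          have hbB : (b : Y) ∈ (B : Set Y) := b.2
          obtain ⟨q, hq1, hqb⟩ : (b : Y) ∈ T '' {q : F × EuclideanSpace ℝ (Fin c) | ‖q.2‖ < 1} :=
            hbB
          have hq1' : ‖q.2‖ < 1 := hq1
          have hq : 1 / 2 < ‖q.2‖ := by
            by_contra h
            rw [not_lt] at h
            have := (hle q).2 h
            rw [hqb] at this
            linarith
          have hq0 : q.2 ≠ 0 := by
            rw [← norm_pos_iff]; exact hq.trans' (by norm_num)
          have htg : b ∈ D.glue.target := by
            rw [htgt]; exact ⟨q, ⟨hq0, hq1'⟩, hqb⟩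
          have hgl : (D.glue.symm b : Y) = T (Ψ q) := hglue' b q hq0 hq1' hqb.symm
          have hge : 1 / 4 ≤ g (D.glue.symm b : Y) := by
            rw [hgl, le_tubeFunction_apply_iff hlt, hnΨ q hq0]
            exact hq.le
          refine Or.inl ⟨RegularSublevel.mk hM (D.glue.symm b : Y) (sub_nonpos.2 hge), ?_⟩
          show D.inl (i₁ _) = D.inr b
          rw [← D.inl_glue_symm htg]
          exact congrArg D.inl (Subtype.ext rfl)
    jA_eq_jB_iff := by
      intro p p'
      constructor
      · intro hpp'
        obtain ⟨hsrc', hgl⟩ := D.inl_eq_inr_iff.1 hpp'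
        have hmem : (RegularSublevel.incl hM p) ∈
            T '' {q : F × EuclideanSpace ℝ (Fin c) | q.2 ≠ 0 ∧ ‖q.2‖ < 1} := by
          have := hsrc'; rwa [hsrc] at this
        obtain ⟨q, hq, hqp⟩ := hmem
        have hgl' : (D.glue (i₁ p) : Y) = T (Ψ' q) := hglue _ q hq.1 hq.2 hqp.symm
        have hp' : RegularSublevel.incl hreg p' = T (Ψ' q) := by
          rw [← hgl']
          exact (congrArg Subtype.val hgl).symm
        -- `‖q.2‖ = ½`: `≥` from `p ∈ {¼ ≤ g}`, `≤` from `p' ∈ {g ≤ ¼}`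
        have hge : 1 / 2 ≤ ‖q.2‖ := (le_tubeFunction_apply_iff hlt q).1 (hqp ▸ hsupM p)
        have hle' : ‖q.2‖ ≤ 1 / 2 := by
          have := (hle _).1 (hp' ▸ hsubN p')
          rwa [hnΨ' q hq.1] at this
        have hq2 : ‖q.2‖ = 1 / 2 := le_antisymm hle' hge
        have hpb : p ∈ (𝓡∂ (k + 1)).boundary (RegularSuperlevel hreg) := by
          rw [hbdM, ← hqp]; exact hval q hq2
        refine ⟨⟨p, hpb⟩, rfl, ?_⟩
        apply RegularSublevel.injective_incl hreg
        show RegularSublevel.incl hreg p' = RegularSublevel.incl hreg (φf ⟨p, hpb⟩).1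
        rw [hφf_apply ⟨p, hpb⟩ q hqp.symm, hp']
      · rintro ⟨z, rfl, rfl⟩
        obtain ⟨q, hq, hqz⟩ := hlevM z
        have hq0 : q.2 ≠ 0 := hhalf0 q hq
        have hq1 : ‖q.2‖ < 1 := by rw [hq]; norm_num
        have hsrc' : i₁ z.1 ∈ D.glue.source := by
          rw [hsrc]; exact ⟨q, ⟨hq0, hq1⟩, hqz⟩
        show D.inl (i₁ z.1) = D.inr (i₂ (φf z).1)
        rw [← D.inr_glue hsrc']
        congr 1
        apply Subtype.ext
        show (D.glue (i₁ z.1) : Y) = RegularSublevel.incl hreg (φf z).1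
        rw [hglue _ q hq0 hq1 hqz.symm, hφf_apply z q hqz.symm] }
  refine ⟨D.Glued, inferInstance, hT2, hsc, hcpt, inferInstance, inferInstance, φ', GP, A, B, hinA,
    hinB, D.inl, D.inr, rfl, rfl, fun z q hzq => hφf_apply z q hzq, D.isSmoothEmbedding_inl,
    D.isOpen_range_inl,
    D.isSmoothEmbedding_inr, D.isOpen_range_inr, D.range_inl_union_range_inr, fun p => rfl,
    fun p => rfl, ?_⟩
  intro a b
  rw [D.inl_eq_inr_iff, hsrc]
  constructor
  · rintro ⟨⟨q, hq, hqa⟩, hab⟩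
    refine ⟨Ψ' q, hne' q hq.1, by rw [hnΨ' q hq.1]; exact hq.2, ?_, ?_⟩
    · rw [← hab]; exact hglue a q hq.1 hq.2 hqa.symm
    · rw [hΨΨ' q hq.1]; exact hqa.symm
  · rintro ⟨q, hq0, hq1, hqb, hqa⟩
    have hΨq0 : (Ψ q).2 ≠ 0 := by
      rw [← norm_ne_zero_iff, hnΨ q hq0, norm_ne_zero_iff]; exact hq0
    have hΨq1 : ‖(Ψ q).2‖ < 1 := by rw [hnΨ q hq0]; exact hq1
    refine ⟨⟨Ψ q, ⟨hΨq0, hΨq1⟩, hqa.symm⟩, ?_⟩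
    apply Subtype.ext
    rw [hglue a (Ψ q) hΨq0 hΨq1 hqa, hΨ'Ψ q hq0]
    exact hqb.symm

end Surgery

end Literature.Topology.FourManifolds
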